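import Literature.MathematicalPhysics.QuantumFieldTheory.Balaban1983to89.B4Eq220CommutatorField

/-!
# [B4] (2.21) AT THE BOUNDARY CUBES: THE `‖·‖_{2,2}` FACTOR BOUND «‖K_{ω_i}G_k(□_{ω_i},Ã_{ω_i})h_{ω_i}‖_{2,2} ≤ c₂O(1)M⁻¹»
# OF [Balaban1983RegularityDecay] ON A FINITE UNION OF UNIT BLOCKS AT A REGULAR FIELD `Ã_j = A` FROM LEMMA 2.1 (2.15)
# — the commutator `K_h = [h, H_k(□,A)]` (2.10) for the region operator of `B4Lemma21Region`, its pointwise and `L^p`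
# bounds, and the reduction "Lemma 2.1 ⇒ the `L² → L²` factor bound", no smallness of `A − A₀` needed

statement-level skeleton of published theorems with citation tags; proofs where landed; nothing here is a claim about the Yang–Mills mass gap

CITATION HEADER.  T. Bałaban, *Regularity and decay of lattice Green's functions*, Commun. Math. Phys. **89** (1983)
571–597, doi:10.1007/bf01214744 [Balaban1983RegularityDecay] (cell paper B4; held text
`paper:balaban1983-cmp89-regularity-decay`, journal page = PDF page + 570; pp. 575–580).  Unit `lit-balaban-p35` gen 5,
HOME `run/shared/lean/pub/lit-balaban/`, SKELETON rows **B4.Eq2.10** (`K_j`) and **B4.Eq2.18** ((2.18)–(2.22): the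
`‖·‖_{2,2}` factors of (2.21)) at the BOUNDARY cubes, complementing `B4Eq220CommutatorField`/`B4Eq220FactorField`
(interior cubes: boxes, `Ã_j = A₀ + θ_jA′`, Lemma 2.2).  Imports `B4Eq220CommutatorField` (→ `B4Lemma21Region`: the
region operator `regionOp` (1.6) on the fine region `fineDom n Ωc` over a finite set `Ωc` of unit labels, its Lemma 2.1
(2.15) at `A ≠ 0` `green_sq_le_region`/`deriv_green_sq_le_region`; `B4Lower18RegularRegion`: `regWt`, `rBlkWt`,
`rbaseEmb`, `rstairContour`, `compField`).

WHAT IS PRINTED.  p. 575: «For Mj lying on the boundary the set □_j is a sum of several (≤ 2^d) large blocks. … if □_j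
intersects the boundary of Ω, then Ã_j = A»; p. 577, Lemma 2.1: «There exist constants e₀, c₂ > 0 independent of k, □,
A (regular) and such that for e ≤ e₀ and arbitrary □ (i.e. not necessarily cubes or parallelepipeds) we have
‖G_k(□,A)f‖₂, ‖(D^η_{A,μ}G_k(□,A))f‖₂, … ≤ c₂‖f‖₂ (2.15)»; p. 578, (2.21): «… Π_{i=n₀+1}^{n}‖K_{ω_i}G_k(□_{ω_i},Ã_{ω_i})
h_{ω_i}‖_{2,2}‖f‖₂ ≤ Σ′_{ω:n>n₀}c₁(c₂O(1)M⁻¹)ⁿ‖f‖_∞»; p. 577: «|∂^ηh_j| ≤ O(M⁻¹), |Δ^ηh_j| ≤ O(M⁻²)».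

WHAT THIS MODULE PROVES (all in full; `d + 1` lattice dimensions; fine region `□ = fineDom n Ωc` = the union of the unit
blocks with labels in the finite set `Ωc ⊂ ℤ^{d+1}`, mesh `η = 1/n`; `A` an ARBITRARY vector field in component form
`A_ν(x)` (`compField`, automatically antisymmetric «A_b̄ = −A_b»), charge `e`, `a ≥ 0`).
* §0 `acBond` (the bond function of `A_ν(x)` on `□`), **`kOpR`** = `K_h = hH_k(□,A) − H_k(□,A)h` for
  `H_k(□,A) = B4Lemma21Region.regionOp` (`kOpR_eq`, rfl); **`HSizeR`** — the sizes of `h` on the region: `|h| ≤ 1`,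
  `|∂^ηh| ≤ δ₁` on the bonds of `□`, `|Δ^{η,N}_□h| ≤ δ₂` (Neumann Laplacian of `□`), block oscillation `≤ δ₃`
  (`B4Eq220CommutatorZeroBox.HSize` is the case of a box).
* §1 **THE POINTWISE BOUND (2.10)** `siteNorm_kOpR_le`:
  `|(K_hφ)(x)| ≤ δ₁Σ_μ(|(D^η_{A,μ}φ)(x)| + |(D^η_{A,μ}φ)(x − ηe_μ)|) + δ₂|φ(x)| + aδ₃n^{−(d+1)}Σ_{x′∈B(x)}|φ(x′)|`
  (`bondTermR_le`, `lapTermR_le`, `avgTermR_le`; links and transporters orthogonal).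
* §2 **NORM BOUNDS** `lpM_kOpR_le` (`‖K_hΦ‖_p ≤ 2δ₁Σ_μ‖D^η_{A,μ}Φ‖_p + (δ₂ + aδ₃)‖Φ‖_p`, every `p ≥ 1`), `supN_kOpR_le`.
* §3 **THE REDUCTION** `eq221_region_reduction_lp`: any `G`, any source functional `ν` with `‖GΨ‖_q ≤ cν(Ψ)`,
  `‖D^η_{A,μ}GΨ‖_q ≤ c′ν(Ψ)` give `‖K_hG(hΦ)‖_q ≤ (2(d+1)δ₁c′ + (δ₂ + aδ₃)c)ν(Φ)`.
* §4 **LEMMA 2.1 ⇒ THE `‖·‖_{2,2}` FACTOR** `eq221_l2_region`: under EXACTLY the hypotheses of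
  `B4Lemma21Region.green_sq_le_region` (Lipschitz flow, `e > 0`, `a > 0`, `m² ≥ 0`, the printed regularity (1.7)
  `|A_ν(x + e_μ) − A_ν(x)| ≤ ce^{β−1}/n` on `□`, and «e ≤ e₀»: `ℓ²((d+1)ce^β)²(d+1)(1 + a(d+1)) ≤ min(2,a)/4`), with
  `γ = min(2,a)/4 + m²`: `‖K_hG_k(□,A)(hΦ)‖₂ ≤ (2(d+1)δ₁γ^{−1/2} + (δ₂ + aδ₃)γ⁻¹)‖Φ‖₂` for every `h` of sizes
  `(δ₁, δ₂, δ₃)` — NO decomposition `A = A₀ + A′`, no smallness of `A′`, arbitrary `□` («not necessarily cubes»);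
  `eq221_l2_region_Minv`: with `δ₁ = δ₃ = s/K`, `δ₂ = s/K²` this is `≤ (2(d+1)γ^{−1/2} + (1 + a)γ⁻¹)·s·K⁻¹·‖Φ‖₂` —
  «c₂O(1)M⁻¹».

HONEST SCOPE.  (i) The sizes of `h` are hypotheses (`HSizeR`); for [B4]'s own `h_j` on a box they are
`B4Eq220PartitionSizes.hsize_hBox` — the boundary cubes `□_j` are unions of `≤ 2^d` large blocks, not boxes, and the
corresponding discharge on block-union regions is not done here.  (ii) Counting-measure `ℓ²` norms (`lpM 2`; at `p = q`
the `η`-weights of the print's `L²(□)` cancel).  (iii) `a` is the coefficient in front of `n^{−(d+1)}Q^*Q` as in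
`B4Lemma21Region.regionOp` (the print's `a_k`; no running of `a_k` is needed for Lemma 2.1).  (iv) Nothing of
(2.12)–(2.13), (2.18)–(2.19), (2.22) is summed here.  Two `abbrev`s (`acBond`, `kOpR`) and one `structure … : Prop`
(`HSizeR`); no `Prop`-valued fact `def`, no `sorry`; axioms standard.
-/

namespace Literature.MathematicalPhysics.QuantumFieldTheory.Balaban1983to89.B4Eq221L2FactorRegion

open Finset Matrix
open Literature.MathematicalPhysics.QuantumFieldTheory.Balaban1983to89.B4GaugeCovariance
open Literature.MathematicalPhysics.QuantumFieldTheory.Balaban1983to89.B4Commutators25to211 (mulH opK fld_opK_mulVec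
  fld_mulH_mulVec)
open Literature.MathematicalPhysics.QuantumFieldTheory.Balaban1983to89.B4Reflection242 (nbrs blk mem_nbrs nbrs_comm)
open Literature.MathematicalPhysics.QuantumFieldTheory.Balaban1983to89.B4Lower18 (fineDom mem_fineDom
  fineDom_isBlockUnion rblk card_filter_rblk)
open Literature.MathematicalPhysics.QuantumFieldTheory.Balaban1983to89.B4Lower18Regular (e1 lsum dotProduct_eq_sum_fld
  dotProduct_self_nonneg')
open Literature.MathematicalPhysics.QuantumFieldTheory.Balaban1983to89.B4Lower18RegularRegion (regWt rBlkWt rbaseEmb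
  rstairContour compField regWt_nonneg rBlkWt_nonneg sum_rBlkWt_col)
open Literature.MathematicalPhysics.QuantumFieldTheory.Balaban1983to89.B4Lemma21Region (siteNorm covDeriv regionOp
  regionDeriv compField_rev green_sq_le_region deriv_green_sq_le_region)
open Literature.MathematicalPhysics.QuantumFieldTheory.Balaban1983to89.B4Lemma22Reduce231 (supN le_supN supN_le
  supN_nonneg siteNorm_nonneg siteNorm_add_le siteNorm_smul)
open Literature.MathematicalPhysics.QuantumFieldTheory.Balaban1983to89.B4Lemma22ReduceDeriv (siteNorm_flow)
open Literature.MathematicalPhysics.QuantumFieldTheory.Balaban1983to89.B4Lemma22PertVSup (bond_fwd bond_bwd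
  contourTrans_fieldLink siteNorm_neg)
open Literature.MathematicalPhysics.QuantumFieldTheory.Balaban1983to89.B4Lemma22LpStair (lpS lpM lpS_nonneg lpM_nonneg
  lpS_mono' lpS_add_le lpS_const_mul lpS_schur lpS_le_of_dirs_add)
open Literature.MathematicalPhysics.QuantumFieldTheory.Balaban1983to89.B4Lemma22ReduceZero (siteNorm_sum_le)
open Literature.MathematicalPhysics.QuantumFieldTheory.Balaban1983to89.B4Eq220CommutatorZeroBox (sum_ite_val)
open Literature.MathematicalPhysics.QuantumFieldTheory.Balaban1983to89.B4Eq220CommutatorField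
  (fieldLink_transpose_of_antisymm lpM_mulH_le supN_mulH_le)

noncomputable section

variable {d : ℕ} {ι : Type} [Fintype ι] [DecidableEq ι]

/-! ## §0. The commutator `K_h = [h, H_k(□,A)]` for the region operator; the sizes of `h` on a region -/

/-- the vector field `A_ν(x)` in component form as a bond function on the fine region
(`B4Lower18RegularRegion.compField` on the sites of `□`). [cite: Balaban1983RegularityDecay, p. 572 (1.2)–(1.3), dictionary] -/
abbrev acBond {n : ℕ} (Ωc : Finset (Fin (d + 1) → ℤ)) (Ac : (Fin (d + 1) → ℤ) → Fin (d + 1) → ℝ) :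
    ↥(fineDom n Ωc) → ↥(fineDom n Ωc) → ℝ :=
  fun u v => compField Ac u.1 v.1

/-- the bond function of a vector field is antisymmetric: «A_b̄ = −A_b». [cite: Balaban1983RegularityDecay, p. 576] -/
theorem acBond_antisymm {n : ℕ} (Ωc : Finset (Fin (d + 1) → ℤ)) (Ac : (Fin (d + 1) → ℤ) → Fin (d + 1) → ℝ)
    (x y : ↥(fineDom n Ωc)) : acBond Ωc Ac y x = -acBond Ωc Ac x y :=
  compField_rev Ac x.1 y.1

/-- **`K_h = hH_k(□,A) − H_k(□,A)h`** for the region operator `H_k(□,A) = −Δ^{η,N}_{A,□} + m² + a·n^{−(d+1)}Q_k(A)^*Q_k(A)`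
of `B4Lemma21Region.regionOp` (fine region `□ = fineDom n Ωc`, Neumann bond weights `regWt`, block weights `rBlkWt`,
base points `rbaseEmb`, staircase contours `rstairContour`, field `A_ν(x)`, charge `e`): `B4Commutators25to211.opK` at
these weights — the operator `K_j` of (2.10) for a boundary cube. [cite: Balaban1983RegularityDecay, (2.10) p. 576] -/
abbrev kOpR (F : OrthFlow ι) (e : ℝ) {n : ℕ} (hn : 1 ≤ n) (a m2 : ℝ) (Ωc : Finset (Fin (d + 1) → ℤ))
    (Ac : (Fin (d + 1) → ℤ) → Fin (d + 1) → ℝ) (h : ↥(fineDom n Ωc) → ℝ) :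
    Matrix (↥(fineDom n Ωc) × ι) (↥(fineDom n Ωc) × ι) ℝ :=
  opK (regWt n (fineDom n Ωc)) m2 (a * ((n : ℝ) ^ (d + 1))⁻¹) (rBlkWt n Ωc (fineDom n Ωc))
    (fieldLink F (e / n) (acBond Ωc Ac))
    (contourTrans (fieldLink F (e / n) (acBond Ωc Ac)) (rbaseEmb hn Ωc) (rstairContour hn Ωc)) h

/-- `K_h = hH − Hh` with `H = B4Lemma21Region.regionOp` (definitional). [cite: Balaban1983RegularityDecay, (2.10) p. 576] -/
theorem kOpR_eq (F : OrthFlow ι) (e : ℝ) {n : ℕ} (hn : 1 ≤ n) (a m2 : ℝ) (Ωc : Finset (Fin (d + 1) → ℤ))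
    (Ac : (Fin (d + 1) → ℤ) → Fin (d + 1) → ℝ) (h : ↥(fineDom n Ωc) → ℝ) :
    kOpR F e hn a m2 Ωc Ac h
      = mulH (ι := ι) h * regionOp F e hn a m2 Ωc Ac - regionOp F e hn a m2 Ωc Ac * mulH (ι := ι) h := rfl

/-- `D^η_{A,μ}` of the region (`B4Lemma21Region.regionDeriv`) is the covariant derivative with the links of `acBond`
(definitional). [cite: Balaban1983RegularityDecay, (1.3) p. 572] -/
theorem regionDeriv_eq (F : OrthFlow ι) (e : ℝ) (n : ℕ) (Ωc : Finset (Fin (d + 1) → ℤ))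
    (Ac : (Fin (d + 1) → ℤ) → Fin (d + 1) → ℝ) (μ : Fin (d + 1)) :
    regionDeriv F e n Ωc Ac μ = covDeriv n (fineDom n Ωc) (fieldLink F (e / n) (acBond Ωc Ac)) μ := rfl

/-- **THE SIZE HYPOTHESES ON THE PARTITION FUNCTION `h` ON A REGION** `□ = fineDom n Ωc` (mesh `n`): `|h| ≤ 1`;
`|∂^ηh| ≤ δ₁` on the bonds of `□` (`n|h(y) − h(x)| ≤ δ₁`, `y ∼ x`, both in `□`); `|Δ^{η,N}_□h| ≤ δ₂`
(`|n²Σ_{y∼x, y∈□}(h(y) − h(x))| ≤ δ₂`, the NEUMANN Laplacian of `□` — for the print's `h_j` it is `Δ^ηh_j`, the normal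
derivative of `h_j` vanishing at `∂□_j`, p. 576); block oscillation `|h(x) − h(y)| ≤ δ₃` within a unit block.  The region
form of `B4Eq220CommutatorZeroBox.HSize`; «|∂^ηh_j| ≤ O(M⁻¹), |Δ^ηh_j| ≤ O(M⁻²)» (p. 577) makes `δ₁, δ₃ = O(M⁻¹)`,
`δ₂ = O(M⁻²)`. [cite: Balaban1983RegularityDecay, p. 575 (h_j), p. 576, p. 577 l. 1–2, dictionary] -/
structure HSizeR (n : ℕ) (Ωc : Finset (Fin (d + 1) → ℤ)) (h : ↥(fineDom n Ωc) → ℝ) (δ₁ δ₂ δ₃ : ℝ) : Prop where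
  nonneg₁ : 0 ≤ δ₁
  nonneg₂ : 0 ≤ δ₂
  nonneg₃ : 0 ≤ δ₃
  abs_le : ∀ x, |h x| ≤ 1
  grad_le : ∀ x y : ↥(fineDom n Ωc), y.1 ∈ nbrs x.1 → (n : ℝ) * |h y - h x| ≤ δ₁
  lap_le : ∀ x : ↥(fineDom n Ωc),
    |(n : ℝ) ^ 2 * ∑ y ∈ univ.filter (fun y : ↥(fineDom n Ωc) => y.1 ∈ nbrs x.1), (h y - h x)| ≤ δ₂
  osc_le : ∀ x y : ↥(fineDom n Ωc), blk n y.1 = blk n x.1 → |h x - h y| ≤ δ₃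

/-! ## §1. The pointwise bound on `K_hφ` for the region operator -/

section Pointwise

variable (F : OrthFlow ι) (e : ℝ) {n : ℕ} (a m2 : ℝ) (Ωc : Finset (Fin (d + 1) → ℤ))
  (Ac : (Fin (d + 1) → ℤ) → Fin (d + 1) → ℝ)

/-- the Neumann bond weights of a region are symmetric. [folklore] -/
private theorem regWt_symm (n : ℕ) (R : Finset (Fin (d + 1) → ℤ)) (x y : ↥R) : regWt n R x y = regWt n R y x := by
  unfold regWt
  by_cases h : y.1 ∈ nbrs x.1
  · rw [if_pos h, if_pos (nbrs_comm.1 h)]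
  · rw [if_neg h, if_neg (fun h' => h (nbrs_comm.1 h'))]

/-- `2·regWt = n²·1[nearest neighbours]`. [folklore] -/
private theorem two_mul_regWt (n : ℕ) (R : Finset (Fin (d + 1) → ℤ)) (x y : ↥R) :
    2 * regWt n R x y = if y.1 ∈ nbrs x.1 then (n : ℝ) ^ 2 else 0 := by
  unfold regWt
  split_ifs <;> ring

/-- the transporters of the region are orthogonal: `|U(A(Γ_{y,x}))ᵀU(A(Γ_{y,x′}))v| = |v|`. [folklore] -/
private theorem siteNorm_trans_transpose_mul (hn : 1 ≤ n) (y : ↥Ωc) (x x' : ↥(fineDom n Ωc)) (v : ι → ℝ) :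
    siteNorm (((contourTrans (fieldLink F (e / n) (acBond Ωc Ac)) (rbaseEmb hn Ωc) (rstairContour hn Ωc) y x)ᵀ
        * contourTrans (fieldLink F (e / n) (acBond Ωc Ac)) (rbaseEmb hn Ωc) (rstairContour hn Ωc) y x') *ᵥ v)
      = siteNorm v := by
  rw [contourTrans_fieldLink, contourTrans_fieldLink, F.transpose_eq, ← mulVec_mulVec, siteNorm_flow, siteNorm_flow]

/-- `Σ_y q(y,z)q(y,z′) ≤ 1[blk z′ = blk z]` for the block weights of a region. [folklore] -/
private theorem sum_rBlkWt_mul_le (z z' : ↥(fineDom n Ωc)) :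
    ∑ y, rBlkWt n Ωc (fineDom n Ωc) y z * rBlkWt n Ωc (fineDom n Ωc) y z'
      ≤ if blk n z'.1 = blk n z.1 then 1 else 0 := by
  by_cases hb : blk n z'.1 = blk n z.1
  · rw [if_pos hb]
    calc ∑ y, rBlkWt n Ωc (fineDom n Ωc) y z * rBlkWt n Ωc (fineDom n Ωc) y z'
        ≤ ∑ y, rBlkWt n Ωc (fineDom n Ωc) y z := sum_le_sum fun y _ => by
          unfold rBlkWt
          split_ifs <;> norm_num
      _ ≤ 1 := sum_rBlkWt_col n Ωc _ z
  · rw [if_neg hb]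
    refine le_of_eq (sum_eq_zero fun y _ => ?_)
    unfold rBlkWt
    by_cases h1 : blk n z.1 = y.1
    · rw [if_neg (fun h2 : blk n z'.1 = y.1 => hb (h2.trans h1.symm)), mul_zero]
    · rw [if_neg h1, zero_mul]

/-- the block kernel `Σ_y q(y,z)q(y,z′)U(A(Γ_{y,z}))ᵀU(A(Γ_{y,z′}))` of `Q_k(A)^*Q_k(A)` is a contraction supported on the
block of `z`: `|P(z,z′)v| ≤ 1[blk z′ = blk z]·|v|`. [cite: Balaban1983RegularityDecay, (1.5) p. 572, (2.8) p. 576] -/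
theorem siteNorm_projKerR_le (hn : 1 ≤ n) (z z' : ↥(fineDom n Ωc)) (v : ι → ℝ) :
    siteNorm ((∑ y, (rBlkWt n Ωc (fineDom n Ωc) y z * rBlkWt n Ωc (fineDom n Ωc) y z')
        • ((contourTrans (fieldLink F (e / n) (acBond Ωc Ac)) (rbaseEmb hn Ωc) (rstairContour hn Ωc) y z)ᵀ
          * contourTrans (fieldLink F (e / n) (acBond Ωc Ac)) (rbaseEmb hn Ωc) (rstairContour hn Ωc) y z')) *ᵥ v)
      ≤ (if blk n z'.1 = blk n z.1 then 1 else 0) * siteNorm v := by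
  rw [Matrix.sum_mulVec]
  refine (siteNorm_sum_le _ _).trans ?_
  have hterm : ∀ y, siteNorm (((rBlkWt n Ωc (fineDom n Ωc) y z * rBlkWt n Ωc (fineDom n Ωc) y z')
      • ((contourTrans (fieldLink F (e / n) (acBond Ωc Ac)) (rbaseEmb hn Ωc) (rstairContour hn Ωc) y z)ᵀ
        * contourTrans (fieldLink F (e / n) (acBond Ωc Ac)) (rbaseEmb hn Ωc) (rstairContour hn Ωc) y z')) *ᵥ v)
      = rBlkWt n Ωc (fineDom n Ωc) y z * rBlkWt n Ωc (fineDom n Ωc) y z' * siteNorm v := by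
    intro y
    rw [Matrix.smul_mulVec, siteNorm_smul, siteNorm_trans_transpose_mul,
      abs_of_nonneg (mul_nonneg (rBlkWt_nonneg n Ωc _ y z) (rBlkWt_nonneg n Ωc _ y z'))]
  simp_rw [hterm]
  rw [← Finset.sum_mul]
  exact mul_le_mul_of_nonneg_right (sum_rBlkWt_mul_le Ωc z z') (siteNorm_nonneg _)

omit [DecidableEq ι] in
/-- `|u − v| ≤ |u| + |v|`. [folklore] -/
private theorem siteNorm_sub_le (u v : ι → ℝ) : siteNorm (u - v) ≤ siteNorm u + siteNorm v := by
  rw [sub_eq_add_neg]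
  exact (siteNorm_add_le u _).trans (by rw [siteNorm_neg])

/-- the star of a site of a region is covered by the `2(d+1)` coordinate bonds. [folklore] -/
private theorem sum_nbrs_le (R : Finset (Fin (d + 1) → ℤ)) (x : ↥R) (G : ↥R → ℝ) (hG : ∀ y, 0 ≤ G y) :
    ∑ y ∈ univ.filter (fun y : ↥R => y.1 ∈ nbrs x.1), G y
      ≤ ∑ μ : Fin (d + 1), ((∑ y : ↥R, if y.1 = x.1 + e1 μ then G y else 0)
          + ∑ y : ↥R, if y.1 = x.1 - e1 μ then G y else 0) := by
  have h0 : ∀ (y : ↥R) (ν : Fin (d + 1)),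
      0 ≤ (if y.1 = x.1 + e1 ν then G y else 0) + (if y.1 = x.1 - e1 ν then G y else 0) :=
    fun y ν => add_nonneg (by split_ifs; exacts [hG y, le_rfl]) (by split_ifs; exacts [hG y, le_rfl])
  have hpt : ∀ y ∈ univ.filter (fun y : ↥R => y.1 ∈ nbrs x.1), G y ≤ ∑ μ : Fin (d + 1),
      ((if y.1 = x.1 + e1 μ then G y else 0) + (if y.1 = x.1 - e1 μ then G y else 0)) := by
    intro y hy
    rw [mem_filter, mem_nbrs] at hy
    obtain ⟨μ, hμ⟩ := hy.2
    refine le_trans ?_ (Finset.single_le_sum (fun ν _ => h0 y ν) (Finset.mem_univ μ))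
    rcases hμ with hμ | hμ
    · have hμ' : y.1 = x.1 + e1 μ := hμ
      rw [if_pos hμ']
      exact le_add_of_nonneg_right (by split_ifs; exacts [hG y, le_rfl])
    · have hμ' : y.1 = x.1 - e1 μ := hμ
      rw [if_pos hμ']
      exact le_add_of_nonneg_left (by split_ifs; exacts [hG y, le_rfl])
  calc ∑ y ∈ univ.filter (fun y : ↥R => y.1 ∈ nbrs x.1), G y
      ≤ ∑ y ∈ univ.filter (fun y : ↥R => y.1 ∈ nbrs x.1), ∑ μ : Fin (d + 1),
          ((if y.1 = x.1 + e1 μ then G y else 0) + (if y.1 = x.1 - e1 μ then G y else 0)) :=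
        Finset.sum_le_sum hpt
    _ ≤ ∑ y : ↥R, ∑ μ : Fin (d + 1),
          ((if y.1 = x.1 + e1 μ then G y else 0) + (if y.1 = x.1 - e1 μ then G y else 0)) :=
        Finset.sum_le_sum_of_subset_of_nonneg (Finset.subset_univ _)
          fun y _ _ => Finset.sum_nonneg fun ν _ => h0 y ν
    _ = ∑ μ : Fin (d + 1), ∑ y : ↥R,
          ((if y.1 = x.1 + e1 μ then G y else 0) + (if y.1 = x.1 - e1 μ then G y else 0)) :=
        Finset.sum_comm
    _ = _ := Finset.sum_congr rfl fun μ _ => Finset.sum_add_distrib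

/-- THE BOND TERM of (2.10) for the region, «Σ_{b∈st(x)}(∂^ηh)(b)(D^η_Aφ)(b)»: under `|∂^ηh| ≤ δ₁` its size at `x` is at
most `δ₁Σ_μ(|(D^η_{A,μ}φ)(x)| + |(D^η_{A,μ}φ)(x − ηe_μ)|)`. [cite: Balaban1983RegularityDecay, (2.10) p. 576, (2.5) p. 576] -/
theorem bondTermR_le (hn : 1 ≤ n) {δ₁ δ₂ δ₃ : ℝ} {h : ↥(fineDom n Ωc) → ℝ} (hh : HSizeR n Ωc h δ₁ δ₂ δ₃)
    (Φ : ↥(fineDom n Ωc) × ι → ℝ) (z : ↥(fineDom n Ωc)) :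
    siteNorm (∑ z', (2 * regWt n (fineDom n Ωc) z z' * (h z' - h z))
        • (fieldLink F (e / n) (acBond Ωc Ac) z z' *ᵥ fld Φ z' - fld Φ z))
      ≤ δ₁ * ∑ μ, (siteNorm (fld (covDeriv n (fineDom n Ωc) (fieldLink F (e / n) (acBond Ωc Ac)) μ *ᵥ Φ) z)
            + (if hz : z.1 - e1 μ ∈ fineDom n Ωc then
                siteNorm (fld (covDeriv n (fineDom n Ωc) (fieldLink F (e / n) (acBond Ωc Ac)) μ *ᵥ Φ)
                  ⟨z.1 - e1 μ, hz⟩)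
              else 0)) := by
  have hn0 : (0 : ℝ) < n := by exact_mod_cast hn
  set W := fieldLink F (e / n) (acBond Ωc Ac) with hWdef
  set G : ↥(fineDom n Ωc) → ℝ := fun y => (n : ℝ) * siteNorm (W z y *ᵥ fld Φ y - fld Φ z) with hGdef
  have hG0 : ∀ y, 0 ≤ G y := fun y => mul_nonneg hn0.le (siteNorm_nonneg _)
  have hterm : ∀ z', siteNorm ((2 * regWt n (fineDom n Ωc) z z' * (h z' - h z))
      • (W z z' *ᵥ fld Φ z' - fld Φ z)) ≤ if z'.1 ∈ nbrs z.1 then δ₁ * G z' else 0 := by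
    intro z'
    rw [siteNorm_smul, two_mul_regWt]
    by_cases hz' : z'.1 ∈ nbrs z.1
    · rw [if_pos hz', if_pos hz', hGdef]
      have hg := hh.grad_le z z' hz'
      rw [abs_mul, abs_of_nonneg (by positivity : (0 : ℝ) ≤ (n : ℝ) ^ 2)]
      calc (n : ℝ) ^ 2 * |h z' - h z| * siteNorm (W z z' *ᵥ fld Φ z' - fld Φ z)
          = ((n : ℝ) * |h z' - h z|) * ((n : ℝ) * siteNorm (W z z' *ᵥ fld Φ z' - fld Φ z)) := by ring
        _ ≤ δ₁ * ((n : ℝ) * siteNorm (W z z' *ᵥ fld Φ z' - fld Φ z)) :=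
            mul_le_mul_of_nonneg_right hg (mul_nonneg hn0.le (siteNorm_nonneg _))
    · rw [if_neg hz', if_neg hz']
      simp
  calc siteNorm (∑ z', (2 * regWt n (fineDom n Ωc) z z' * (h z' - h z)) • (W z z' *ᵥ fld Φ z' - fld Φ z))
      ≤ ∑ z', siteNorm ((2 * regWt n (fineDom n Ωc) z z' * (h z' - h z)) • (W z z' *ᵥ fld Φ z' - fld Φ z)) :=
        siteNorm_sum_le _ _
    _ ≤ ∑ z', (if z'.1 ∈ nbrs z.1 then δ₁ * G z' else 0) := sum_le_sum fun z' _ => hterm z'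
    _ = δ₁ * ∑ z' ∈ univ.filter (fun y : ↥(fineDom n Ωc) => y.1 ∈ nbrs z.1), G z' := by
        rw [Finset.sum_filter, Finset.mul_sum]
        exact sum_congr rfl fun z' _ => by split_ifs <;> simp
    _ ≤ δ₁ * ∑ μ : Fin (d + 1), ((∑ y : ↥(fineDom n Ωc), if y.1 = z.1 + e1 μ then G y else 0)
          + ∑ y : ↥(fineDom n Ωc), if y.1 = z.1 - e1 μ then G y else 0) :=
        mul_le_mul_of_nonneg_left (sum_nbrs_le _ z G hG0) hh.nonneg₁
    _ ≤ δ₁ * ∑ μ, (siteNorm (fld (covDeriv n (fineDom n Ωc) W μ *ᵥ Φ) z)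
            + (if hz : z.1 - e1 μ ∈ fineDom n Ωc then
                siteNorm (fld (covDeriv n (fineDom n Ωc) W μ *ᵥ Φ) ⟨z.1 - e1 μ, hz⟩) else 0)) := by
        refine mul_le_mul_of_nonneg_left (sum_le_sum fun μ _ => add_le_add ?_ ?_) hh.nonneg₁
        · -- forward bond `⟨z, z + e_μ⟩`
          rw [sum_ite_val (fineDom n Ωc) (z.1 + e1 μ) G]
          by_cases hm : z.1 + e1 μ ∈ fineDom n Ωc
          · rw [dif_pos hm, hGdef]
            have hb := bond_fwd hn W μ Φ (z := z) (y := ⟨z.1 + e1 μ, hm⟩) rfl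
            simp only []
            rw [hb, siteNorm_smul, abs_of_nonneg (inv_nonneg.2 hn0.le), ← mul_assoc, mul_inv_cancel₀ hn0.ne',
              one_mul]
          · rw [dif_neg hm]
            exact siteNorm_nonneg _
        · -- backward bond `⟨z − e_μ, z⟩`
          rw [sum_ite_val (fineDom n Ωc) (z.1 - e1 μ) G]
          by_cases hm : z.1 - e1 μ ∈ fineDom n Ωc
          · rw [dif_pos hm, dif_pos hm, hGdef]
            have hzy : z.1 = (⟨z.1 - e1 μ, hm⟩ : ↥(fineDom n Ωc)).1 + e1 μ := by
              simp only [sub_add_cancel]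
            have hb := bond_bwd F (e / n) hn (acBond Ωc Ac) (acBond_antisymm Ωc Ac) μ Φ (z := z)
              (y := ⟨z.1 - e1 μ, hm⟩) hzy
            simp only []
            rw [hWdef, hb, siteNorm_neg]
            rw [show fieldLink F (e / n) (acBond Ωc Ac) z ⟨z.1 - e1 μ, hm⟩
                = F.U (e / n * acBond Ωc Ac z ⟨z.1 - e1 μ, hm⟩) from rfl, siteNorm_flow,
              siteNorm_smul, abs_of_nonneg (inv_nonneg.2 hn0.le), ← mul_assoc, mul_inv_cancel₀ hn0.ne', one_mul]
          · rw [dif_neg hm, dif_neg hm]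

omit [DecidableEq ι] in
/-- THE LAPLACIAN TERM of (2.10) for the region, «(Δ^ηh)(x)φ(x)» (Neumann Laplacian of `h` on `□`): size `≤ δ₂|φ(x)|`.
[cite: Balaban1983RegularityDecay, (2.10) p. 576, (2.7) p. 576] -/
theorem lapTermR_le {δ₁ δ₂ δ₃ : ℝ} {h : ↥(fineDom n Ωc) → ℝ} (hh : HSizeR n Ωc h δ₁ δ₂ δ₃)
    (Φ : ↥(fineDom n Ωc) × ι → ℝ) (z : ↥(fineDom n Ωc)) :
    siteNorm ((∑ z', 2 * regWt n (fineDom n Ωc) z z' * (h z' - h z)) • fld Φ z) ≤ δ₂ * siteNorm (fld Φ z) := by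
  rw [siteNorm_smul]
  refine mul_le_mul_of_nonneg_right ?_ (siteNorm_nonneg _)
  have hsum : ∑ z', 2 * regWt n (fineDom n Ωc) z z' * (h z' - h z)
      = (n : ℝ) ^ 2 * ∑ z' ∈ univ.filter (fun y : ↥(fineDom n Ωc) => y.1 ∈ nbrs z.1), (h z' - h z) := by
    rw [Finset.sum_filter, Finset.mul_sum]
    refine sum_congr rfl fun z' _ => ?_
    rw [two_mul_regWt]
    split_ifs <;> simp
  rw [hsum]
  exact hh.lap_le z

/-- THE AVERAGING TERM of (2.10) for the region, «Σ_{x′∈B^k(y^k(x))}η^d(∂^ηh)(Γ^{(k)}_{x,y^k(x),x′})U(A(Γ^{(k)}_{x,y^k(x),x′}))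
φ(x′)» (coefficient `a·n^{−(d+1)}`): size `≤ aδ₃·n^{−(d+1)}Σ_{x′∈B(x)}|φ(x′)|` — the transporters are orthogonal.
[cite: Balaban1983RegularityDecay, (2.10) p. 576, (2.8) p. 576] -/
theorem avgTermR_le (hn : 1 ≤ n) (ha : 0 ≤ a) {δ₁ δ₂ δ₃ : ℝ} {h : ↥(fineDom n Ωc) → ℝ} (hh : HSizeR n Ωc h δ₁ δ₂ δ₃)
    (Φ : ↥(fineDom n Ωc) × ι → ℝ) (z : ↥(fineDom n Ωc)) :
    siteNorm ((a * ((n : ℝ) ^ (d + 1))⁻¹) • ∑ z', (h z' - h z)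
        • ((∑ y, (rBlkWt n Ωc (fineDom n Ωc) y z * rBlkWt n Ωc (fineDom n Ωc) y z')
            • ((contourTrans (fieldLink F (e / n) (acBond Ωc Ac)) (rbaseEmb hn Ωc) (rstairContour hn Ωc) y z)ᵀ
              * contourTrans (fieldLink F (e / n) (acBond Ωc Ac)) (rbaseEmb hn Ωc) (rstairContour hn Ωc) y z'))
          *ᵥ fld Φ z'))
      ≤ a * δ₃ * (((n : ℝ) ^ (d + 1))⁻¹
          * ∑ z' ∈ univ.filter (fun y : ↥(fineDom n Ωc) => blk n y.1 = blk n z.1), siteNorm (fld Φ z')) := by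
  have hN : (0 : ℝ) ≤ ((n : ℝ) ^ (d + 1))⁻¹ := inv_nonneg.2 (by positivity)
  rw [siteNorm_smul, abs_of_nonneg (mul_nonneg ha hN)]
  have hterm : ∀ z', siteNorm ((h z' - h z)
      • ((∑ y, (rBlkWt n Ωc (fineDom n Ωc) y z * rBlkWt n Ωc (fineDom n Ωc) y z')
          • ((contourTrans (fieldLink F (e / n) (acBond Ωc Ac)) (rbaseEmb hn Ωc) (rstairContour hn Ωc) y z)ᵀ
            * contourTrans (fieldLink F (e / n) (acBond Ωc Ac)) (rbaseEmb hn Ωc) (rstairContour hn Ωc) y z'))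
        *ᵥ fld Φ z'))
      ≤ if blk n z'.1 = blk n z.1 then δ₃ * siteNorm (fld Φ z') else 0 := by
    intro z'
    rw [siteNorm_smul]
    refine (mul_le_mul_of_nonneg_left (siteNorm_projKerR_le F e Ωc Ac hn z z' (fld Φ z')) (abs_nonneg _)).trans ?_
    by_cases hb : blk n z'.1 = blk n z.1
    · rw [if_pos hb, if_pos hb, one_mul]
      refine mul_le_mul_of_nonneg_right ?_ (siteNorm_nonneg _)
      rw [abs_sub_comm]
      exact hh.osc_le z z' hb
    · rw [if_neg hb, if_neg hb]
      simp
  calc a * ((n : ℝ) ^ (d + 1))⁻¹ * siteNorm (∑ z', (h z' - h z)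
        • ((∑ y, (rBlkWt n Ωc (fineDom n Ωc) y z * rBlkWt n Ωc (fineDom n Ωc) y z')
          • ((contourTrans (fieldLink F (e / n) (acBond Ωc Ac)) (rbaseEmb hn Ωc) (rstairContour hn Ωc) y z)ᵀ
            * contourTrans (fieldLink F (e / n) (acBond Ωc Ac)) (rbaseEmb hn Ωc) (rstairContour hn Ωc) y z'))
          *ᵥ fld Φ z'))
      ≤ a * ((n : ℝ) ^ (d + 1))⁻¹ * ∑ z', (if blk n z'.1 = blk n z.1 then δ₃ * siteNorm (fld Φ z') else 0) :=
        mul_le_mul_of_nonneg_left ((siteNorm_sum_le _ _).trans (sum_le_sum fun z' _ => hterm z'))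
          (mul_nonneg ha hN)
    _ = a * δ₃ * (((n : ℝ) ^ (d + 1))⁻¹
          * ∑ z' ∈ univ.filter (fun y : ↥(fineDom n Ωc) => blk n y.1 = blk n z.1), siteNorm (fld Φ z')) := by
        rw [Finset.sum_filter, Finset.mul_sum, Finset.mul_sum, Finset.mul_sum]
        refine sum_congr rfl fun z' _ => ?_
        split_ifs <;> ring

/-- **THE POINTWISE BOUND ON `K_hφ` FOR THE REGION OPERATOR AT AN ARBITRARY VECTOR FIELD**: under the sizes `HSizeR`,
`|(K_hφ)(x)| ≤ δ₁Σ_μ(|(D^η_{A,μ}φ)(x)| + |(D^η_{A,μ}φ)(x − ηe_μ)|) + δ₂|φ(x)| + aδ₃n^{−(d+1)}Σ_{x′∈B(x)}|φ(x′)|` — the links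
and transporters are orthogonal; no regularity or smallness of `A` enters.
[cite: Balaban1983RegularityDecay, (2.10) p. 576; p. 577 «|∂^ηh_j| ≤ O(M⁻¹), |Δ^ηh_j| ≤ O(M⁻²)»] -/
theorem siteNorm_kOpR_le (hn : 1 ≤ n) (ha : 0 ≤ a) {δ₁ δ₂ δ₃ : ℝ} {h : ↥(fineDom n Ωc) → ℝ} (hh : HSizeR n Ωc h δ₁ δ₂ δ₃)
    (Φ : ↥(fineDom n Ωc) × ι → ℝ) (z : ↥(fineDom n Ωc)) :
    siteNorm (fld (kOpR F e hn a m2 Ωc Ac h *ᵥ Φ) z)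
      ≤ δ₁ * ∑ μ, (siteNorm (fld (covDeriv n (fineDom n Ωc) (fieldLink F (e / n) (acBond Ωc Ac)) μ *ᵥ Φ) z)
            + (if hz : z.1 - e1 μ ∈ fineDom n Ωc then
                siteNorm (fld (covDeriv n (fineDom n Ωc) (fieldLink F (e / n) (acBond Ωc Ac)) μ *ᵥ Φ)
                  ⟨z.1 - e1 μ, hz⟩)
              else 0))
        + δ₂ * siteNorm (fld Φ z)
        + a * δ₃ * (((n : ℝ) ^ (d + 1))⁻¹
            * ∑ z' ∈ univ.filter (fun y : ↥(fineDom n Ωc) => blk n y.1 = blk n z.1), siteNorm (fld Φ z')) := by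
  have hc : ∀ z z' : ↥(fineDom n Ωc), regWt n (fineDom n Ωc) z z' = regWt n (fineDom n Ωc) z' z := regWt_symm n _
  have hW : ∀ z z' : ↥(fineDom n Ωc), regWt n (fineDom n Ωc) z z' ≠ 0 →
      (fieldLink F (e / n) (acBond Ωc Ac) z' z)ᵀ = fieldLink F (e / n) (acBond Ωc Ac) z z' :=
    fun z z' _ => fieldLink_transpose_of_antisymm F (e / n) (acBond Ωc Ac) (acBond_antisymm Ωc Ac) z z'
  rw [kOpR, fld_opK_mulVec (ι := ι) (regWt n (fineDom n Ωc)) m2 (a * ((n : ℝ) ^ (d + 1))⁻¹)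
    (rBlkWt n Ωc (fineDom n Ωc)) (fieldLink F (e / n) (acBond Ωc Ac))
    (contourTrans (fieldLink F (e / n) (acBond Ωc Ac)) (rbaseEmb hn Ωc) (rstairContour hn Ωc)) hc hW h Φ z]
  have h1 := bondTermR_le (ι := ι) F e Ωc Ac hn hh Φ z
  have h2 := lapTermR_le (ι := ι) Ωc hh Φ z
  have h3 := avgTermR_le (ι := ι) F e a Ωc Ac hn ha hh Φ z
  refine (siteNorm_sub_le _ _).trans ?_
  exact add_le_add ((siteNorm_add_le (ι := ι) _ _).trans (add_le_add h1 h2)) h3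

end Pointwise

/-! ## §2. The `L^p` and sup-norm bounds on `K_h` for the region -/

section Norms

variable (F : OrthFlow ι) (e : ℝ) {n : ℕ} (a m2 : ℝ) (Ωc : Finset (Fin (d + 1) → ℤ))
  (Ac : (Fin (d + 1) → ℤ) → Fin (d + 1) → ℝ)

/-- every unit block of the region has exactly `n^{d+1}` sites. [folklore] -/
private theorem card_blkClass (hn : 1 ≤ n) (z : ↥(fineDom n Ωc)) :
    (univ.filter (fun y : ↥(fineDom n Ωc) => blk n y.1 = blk n z.1)).card = n ^ (d + 1) := by
  have h := card_filter_rblk hn (fineDom_isBlockUnion hn Ωc) (rblk n (fineDom n Ωc) z)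
  have heq : (univ.filter fun y : ↥(fineDom n Ωc) => blk n y.1 = blk n z.1)
      = univ.filter fun y => rblk n (fineDom n Ωc) y = rblk n (fineDom n Ωc) z := by
    ext y
    simp only [Finset.mem_filter, Finset.mem_univ, true_and, rblk, Subtype.ext_iff]
  rw [heq, h]

omit [DecidableEq ι] in
/-- the block mean of `|φ|` is an `ℓ^p` contraction (`p ≥ 1`): the kernel `n^{−(d+1)}1[blk z′ = blk z]` has unit row
and column sums on a union of blocks — Schur test. [folklore] -/
private theorem lpS_blkMean_le (hn : 1 ≤ n) {p : ℝ} (hp : 1 ≤ p) (Φ : ↥(fineDom n Ωc) × ι → ℝ) :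
    lpS p (fun z : ↥(fineDom n Ωc) => ((n : ℝ) ^ (d + 1))⁻¹
        * ∑ z' ∈ univ.filter (fun y : ↥(fineDom n Ωc) => blk n y.1 = blk n z.1), siteNorm (fld Φ z'))
      ≤ lpM p Φ := by
  have hN : (0 : ℝ) < (n : ℝ) ^ (d + 1) := by positivity
  have hk : ∀ z z' : ↥(fineDom n Ωc),
      0 ≤ ((n : ℝ) ^ (d + 1))⁻¹ * (if blk n z'.1 = blk n z.1 then (1 : ℝ) else 0) := fun z z' =>
    mul_nonneg (inv_nonneg.2 hN.le) (by split_ifs <;> norm_num)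
  have hrow : ∀ z : ↥(fineDom n Ωc),
      ∑ z' : ↥(fineDom n Ωc), ((n : ℝ) ^ (d + 1))⁻¹ * (if blk n z'.1 = blk n z.1 then (1 : ℝ) else 0) ≤ 1 := by
    intro z
    rw [← Finset.mul_sum, ← Finset.sum_filter, Finset.sum_const, nsmul_eq_mul, mul_one, card_blkClass Ωc hn z]
    push_cast
    rw [inv_mul_cancel₀ hN.ne']
  have hcol : ∀ z' : ↥(fineDom n Ωc),
      ∑ z : ↥(fineDom n Ωc), ((n : ℝ) ^ (d + 1))⁻¹ * (if blk n z'.1 = blk n z.1 then (1 : ℝ) else 0) ≤ 1 := by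
    intro z'
    have he : ∀ z : ↥(fineDom n Ωc),
        (if blk n z'.1 = blk n z.1 then (1 : ℝ) else 0) = (if blk n z.1 = blk n z'.1 then (1 : ℝ) else 0) :=
      fun z => by simp only [eq_comm]
    simp_rw [he]
    rw [← Finset.mul_sum, ← Finset.sum_filter, Finset.sum_const, nsmul_eq_mul, mul_one, card_blkClass Ωc hn z']
    push_cast
    rw [inv_mul_cancel₀ hN.ne']
  have h := lpS_schur hp (ψ := fun z : ↥(fineDom n Ωc) => ((n : ℝ) ^ (d + 1))⁻¹
      * ∑ z' ∈ univ.filter (fun y : ↥(fineDom n Ωc) => blk n y.1 = blk n z.1), siteNorm (fld Φ z'))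
    (φ := fun z' => siteNorm (fld Φ z'))
    (fun z => mul_nonneg (inv_nonneg.2 hN.le) (sum_nonneg fun _ _ => siteNorm_nonneg _))
    (fun _ => siteNorm_nonneg _) hk (fun z => le_of_eq ?_) zero_le_one hrow hcol
  · simpa only [one_mul, lpM] using h
  · rw [Finset.sum_filter, Finset.mul_sum]
    exact sum_congr rfl fun z' _ => by split_ifs <;> simp

omit [DecidableEq ι] in
/-- the block mean of `|φ|` is bounded by `‖Φ‖_∞`. [folklore] -/
private theorem blkMean_le_supN (hn : 1 ≤ n) (Φ : ↥(fineDom n Ωc) × ι → ℝ) (z : ↥(fineDom n Ωc)) :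
    ((n : ℝ) ^ (d + 1))⁻¹ * ∑ z' ∈ univ.filter (fun y : ↥(fineDom n Ωc) => blk n y.1 = blk n z.1),
        siteNorm (fld Φ z') ≤ supN Φ := by
  have hN : (0 : ℝ) < (n : ℝ) ^ (d + 1) := by positivity
  calc ((n : ℝ) ^ (d + 1))⁻¹ * ∑ z' ∈ univ.filter (fun y : ↥(fineDom n Ωc) => blk n y.1 = blk n z.1),
        siteNorm (fld Φ z')
      ≤ ((n : ℝ) ^ (d + 1))⁻¹ * ∑ z' ∈ univ.filter (fun y : ↥(fineDom n Ωc) => blk n y.1 = blk n z.1), supN Φ :=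
        mul_le_mul_of_nonneg_left (sum_le_sum fun z' _ => le_supN Φ z') (inv_nonneg.2 hN.le)
    _ = supN Φ := by
        rw [Finset.sum_const, nsmul_eq_mul, card_blkClass Ωc hn z]
        push_cast
        rw [← mul_assoc, inv_mul_cancel₀ hN.ne', one_mul]

/-- **`‖K_hΦ‖_p ≤ 2δ₁Σ_μ‖D^η_{A,μ}Φ‖_p + (δ₂ + aδ₃)‖Φ‖_p` FOR EVERY `p ≥ 1`** for the region operator at an arbitrary
vector field (counting-measure mixed norms `B4Lemma22LpStair.lpM`).
[cite: Balaban1983RegularityDecay, (2.10) p. 576, p. 577, (2.21) p. 578] -/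
theorem lpM_kOpR_le (hn : 1 ≤ n) (ha : 0 ≤ a) {δ₁ δ₂ δ₃ : ℝ} {h : ↥(fineDom n Ωc) → ℝ} (hh : HSizeR n Ωc h δ₁ δ₂ δ₃) {p : ℝ}
    (hp : 1 ≤ p) (Φ : ↥(fineDom n Ωc) × ι → ℝ) :
    lpM p (kOpR F e hn a m2 Ωc Ac h *ᵥ Φ)
      ≤ δ₁ * (2 * ∑ μ, lpM p (covDeriv n (fineDom n Ωc) (fieldLink F (e / n) (acBond Ωc Ac)) μ *ᵥ Φ))
        + (δ₂ + a * δ₃) * lpM p Φ := by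
  have hp0 : 0 < p := by linarith
  set D : Fin (d + 1) → ↥(fineDom n Ωc) × ι → ℝ :=
    fun μ => covDeriv n (fineDom n Ωc) (fieldLink F (e / n) (acBond Ωc Ac)) μ *ᵥ Φ with hD
  set AB : ↥(fineDom n Ωc) → ℝ := fun z =>
    δ₁ * ∑ μ, (siteNorm (fld (D μ) z)
        + (if hz : z.1 - e1 μ ∈ fineDom n Ωc then siteNorm (fld (D μ) ⟨z.1 - e1 μ, hz⟩) else 0))
      + δ₂ * siteNorm (fld Φ z) with hAB
  set C : ↥(fineDom n Ωc) → ℝ := fun z =>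
    a * δ₃ * (((n : ℝ) ^ (d + 1))⁻¹
      * ∑ z' ∈ univ.filter (fun y : ↥(fineDom n Ωc) => blk n y.1 = blk n z.1), siteNorm (fld Φ z')) with hC
  have hAB0 : ∀ z, 0 ≤ AB z := fun z =>
    add_nonneg (mul_nonneg hh.nonneg₁ (sum_nonneg fun μ _ => add_nonneg (siteNorm_nonneg _)
      (by split_ifs <;> first | exact siteNorm_nonneg _ | exact le_rfl))) (mul_nonneg hh.nonneg₂ (siteNorm_nonneg _))
  have hC0 : ∀ z, 0 ≤ C z := fun z => mul_nonneg (mul_nonneg ha hh.nonneg₃)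
    (mul_nonneg (inv_nonneg.2 (by positivity)) (sum_nonneg fun _ _ => siteNorm_nonneg _))
  have hpt : ∀ z, siteNorm (fld (kOpR F e hn a m2 Ωc Ac h *ᵥ Φ) z) ≤ AB z + C z := fun z =>
    siteNorm_kOpR_le F e a m2 Ωc Ac hn ha hh Φ z
  have h1 : lpS p AB ≤ δ₁ * (2 * ∑ μ, lpM p (D μ)) + δ₂ * lpM p Φ :=
    lpS_le_of_dirs_add hp hh.nonneg₁ hh.nonneg₂ D Φ hAB0 fun z => le_rfl
  have h2 : lpS p C ≤ a * δ₃ * lpM p Φ := by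
    rw [hC, lpS_const_mul hp0.ne' (mul_nonneg ha hh.nonneg₃)]
    exact mul_le_mul_of_nonneg_left (lpS_blkMean_le Ωc hn hp Φ) (mul_nonneg ha hh.nonneg₃)
  calc lpM p (kOpR F e hn a m2 Ωc Ac h *ᵥ Φ)
      ≤ lpS p (fun z => AB z + C z) := lpS_mono' hp0 (fun z => siteNorm_nonneg _) hpt
    _ ≤ lpS p AB + lpS p C := lpS_add_le hp _ _
    _ ≤ δ₁ * (2 * ∑ μ, lpM p (D μ)) + δ₂ * lpM p Φ + a * δ₃ * lpM p Φ := add_le_add h1 h2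
    _ = δ₁ * (2 * ∑ μ, lpM p (D μ)) + (δ₂ + a * δ₃) * lpM p Φ := by ring

/-- **`‖K_hΦ‖_∞ ≤ 2δ₁Σ_μ‖D^η_{A,μ}Φ‖_∞ + (δ₂ + aδ₃)‖Φ‖_∞`** for the region operator at an arbitrary vector field.
[cite: Balaban1983RegularityDecay, (2.10) p. 576, p. 577, (2.20) p. 578] -/
theorem supN_kOpR_le (hn : 1 ≤ n) (ha : 0 ≤ a) {δ₁ δ₂ δ₃ : ℝ} {h : ↥(fineDom n Ωc) → ℝ} (hh : HSizeR n Ωc h δ₁ δ₂ δ₃)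
    (Φ : ↥(fineDom n Ωc) × ι → ℝ) :
    supN (kOpR F e hn a m2 Ωc Ac h *ᵥ Φ)
      ≤ δ₁ * (2 * ∑ μ, supN (covDeriv n (fineDom n Ωc) (fieldLink F (e / n) (acBond Ωc Ac)) μ *ᵥ Φ))
        + (δ₂ + a * δ₃) * supN Φ := by
  set D : Fin (d + 1) → ↥(fineDom n Ωc) × ι → ℝ :=
    fun μ => covDeriv n (fineDom n Ωc) (fieldLink F (e / n) (acBond Ωc Ac)) μ *ᵥ Φ with hD
  have hS0 : 0 ≤ ∑ μ, supN (D μ) := sum_nonneg fun μ _ => supN_nonneg _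
  refine supN_le (add_nonneg (mul_nonneg hh.nonneg₁ (mul_nonneg zero_le_two hS0))
    (mul_nonneg (add_nonneg hh.nonneg₂ (mul_nonneg ha hh.nonneg₃)) (supN_nonneg _))) fun z => ?_
  refine (siteNorm_kOpR_le F e a m2 Ωc Ac hn ha hh Φ z).trans ?_
  have hdirs : ∑ μ, (siteNorm (fld (D μ) z)
      + (if hz : z.1 - e1 μ ∈ fineDom n Ωc then siteNorm (fld (D μ) ⟨z.1 - e1 μ, hz⟩) else 0))
      ≤ 2 * ∑ μ, supN (D μ) := by
    rw [two_mul, ← sum_add_distrib]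
    refine sum_le_sum fun μ _ => add_le_add (le_supN _ _) ?_
    split_ifs
    · exact le_supN _ _
    · exact supN_nonneg _
  have hblk := blkMean_le_supN Ωc hn Φ z
  have h3 : a * δ₃ * (((n : ℝ) ^ (d + 1))⁻¹
      * ∑ z' ∈ univ.filter (fun y : ↥(fineDom n Ωc) => blk n y.1 = blk n z.1), siteNorm (fld Φ z'))
      ≤ a * δ₃ * supN Φ := mul_le_mul_of_nonneg_left hblk (mul_nonneg ha hh.nonneg₃)
  have h2 : δ₂ * siteNorm (fld Φ z) ≤ δ₂ * supN Φ := mul_le_mul_of_nonneg_left (le_supN Φ z) hh.nonneg₂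
  have h1 := mul_le_mul_of_nonneg_left hdirs hh.nonneg₁
  linarith

end Norms

/-! ## §3. The reduction "the `L^p`/sup members of (2.15)/(2.17) ⇒ the factor bound" for the region operator -/

section Reduction

variable (F : OrthFlow ι) (e : ℝ) {n : ℕ} (a m2 : ℝ) (Ωc : Finset (Fin (d + 1) → ℤ))
  (Ac : (Fin (d + 1) → ℤ) → Fin (d + 1) → ℝ)

/-- **THE REDUCTION FOR THE REGION OPERATOR, TARGET `‖·‖_q`, `q ∈ [1,∞)`**: for ANY operator `G` on the region (in the
application `G = G_k(□,A)`) and any source functional `ν` with `‖GΨ‖_q ≤ c·ν(Ψ)`, `‖D^η_{A,μ}GΨ‖_q ≤ c′·ν(Ψ)`, for `h`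
of sizes `(δ₁, δ₂, δ₃)` and `ν(hΦ) ≤ ν(Φ)`: `‖K_hG(hΦ)‖_q ≤ (2(d+1)δ₁c′ + (δ₂ + aδ₃)c)·ν(Φ)`.
[cite: Balaban1983RegularityDecay, (2.21) p. 578 with (2.10) p. 576, p. 577 and Lemma 2.1 (2.15) p. 577] -/
theorem eq221_region_reduction_lp (hn : 1 ≤ n) (ha : 0 ≤ a) {q : ℝ} (hq : 1 ≤ q)
    {ν : (↥(fineDom n Ωc) × ι → ℝ) → ℝ} {c c' : ℝ} (hc : 0 ≤ c) (hc' : 0 ≤ c')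
    (G : Matrix (↥(fineDom n Ωc) × ι) (↥(fineDom n Ωc) × ι) ℝ)
    (hG : ∀ Ψ, lpM q (G *ᵥ Ψ) ≤ c * ν Ψ)
    (hD : ∀ (μ : Fin (d + 1)) Ψ,
      lpM q (covDeriv n (fineDom n Ωc) (fieldLink F (e / n) (acBond Ωc Ac)) μ *ᵥ (G *ᵥ Ψ)) ≤ c' * ν Ψ)
    {δ₁ δ₂ δ₃ : ℝ} {h : ↥(fineDom n Ωc) → ℝ} (hh : HSizeR n Ωc h δ₁ δ₂ δ₃)
    (Φ : ↥(fineDom n Ωc) × ι → ℝ) (hν : ν (mulH (ι := ι) h *ᵥ Φ) ≤ ν Φ) :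
    lpM q (kOpR F e hn a m2 Ωc Ac h *ᵥ (G *ᵥ (mulH (ι := ι) h *ᵥ Φ)))
      ≤ (2 * ((d : ℝ) + 1) * δ₁ * c' + (δ₂ + a * δ₃) * c) * ν Φ := by
  have hK := lpM_kOpR_le F e a m2 Ωc Ac hn ha hh hq (G *ᵥ (mulH (ι := ι) h *ᵥ Φ))
  have h0 : lpM q (G *ᵥ (mulH (ι := ι) h *ᵥ Φ)) ≤ c * ν Φ :=
    (hG _).trans (mul_le_mul_of_nonneg_left hν hc)
  have h1 : ∀ μ : Fin (d + 1), lpM q (covDeriv n (fineDom n Ωc) (fieldLink F (e / n) (acBond Ωc Ac)) μ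
      *ᵥ (G *ᵥ (mulH (ι := ι) h *ᵥ Φ))) ≤ c' * ν Φ := fun μ =>
    (hD μ _).trans (mul_le_mul_of_nonneg_left hν hc')
  have hsum : ∑ μ : Fin (d + 1), lpM q (covDeriv n (fineDom n Ωc) (fieldLink F (e / n) (acBond Ωc Ac)) μ
      *ᵥ (G *ᵥ (mulH (ι := ι) h *ᵥ Φ))) ≤ ((d : ℝ) + 1) * (c' * ν Φ) := by
    refine (sum_le_sum fun μ _ => h1 μ).trans ?_
    rw [sum_const, card_univ, Fintype.card_fin, nsmul_eq_mul, Nat.cast_add, Nat.cast_one]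
  have hδ₁ : 0 ≤ δ₁ * 2 := by linarith [hh.nonneg₁]
  have hδ₂₃ : 0 ≤ δ₂ + a * δ₃ := add_nonneg hh.nonneg₂ (mul_nonneg ha hh.nonneg₃)
  calc _ ≤ _ := hK
    _ ≤ δ₁ * (2 * (((d : ℝ) + 1) * (c' * ν Φ))) + (δ₂ + a * δ₃) * (c * ν Φ) :=
        add_le_add (by rw [← mul_assoc, ← mul_assoc]; exact mul_le_mul_of_nonneg_left hsum hδ₁)
          (mul_le_mul_of_nonneg_left h0 hδ₂₃)
    _ = (2 * ((d : ℝ) + 1) * δ₁ * c' + (δ₂ + a * δ₃) * c) * ν Φ := by ring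

/-- **THE REDUCTION FOR THE REGION OPERATOR, TARGET `‖·‖_∞`**: `‖K_hG(hΦ)‖_∞ ≤ (2(d+1)δ₁c′ + (δ₂ + aδ₃)c)·ν(Φ)` under
`‖GΨ‖_∞ ≤ cν(Ψ)`, `‖D^η_{A,μ}GΨ‖_∞ ≤ c′ν(Ψ)`.
[cite: Balaban1983RegularityDecay, (2.20)–(2.21) p. 578 with (2.10) p. 576, p. 577] -/
theorem eq221_region_reduction_sup (hn : 1 ≤ n) (ha : 0 ≤ a)
    {ν : (↥(fineDom n Ωc) × ι → ℝ) → ℝ} {c c' : ℝ} (hc : 0 ≤ c) (hc' : 0 ≤ c')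
    (G : Matrix (↥(fineDom n Ωc) × ι) (↥(fineDom n Ωc) × ι) ℝ)
    (hG : ∀ Ψ, supN (G *ᵥ Ψ) ≤ c * ν Ψ)
    (hD : ∀ (μ : Fin (d + 1)) Ψ,
      supN (covDeriv n (fineDom n Ωc) (fieldLink F (e / n) (acBond Ωc Ac)) μ *ᵥ (G *ᵥ Ψ)) ≤ c' * ν Ψ)
    {δ₁ δ₂ δ₃ : ℝ} {h : ↥(fineDom n Ωc) → ℝ} (hh : HSizeR n Ωc h δ₁ δ₂ δ₃)
    (Φ : ↥(fineDom n Ωc) × ι → ℝ) (hν : ν (mulH (ι := ι) h *ᵥ Φ) ≤ ν Φ) :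
    supN (kOpR F e hn a m2 Ωc Ac h *ᵥ (G *ᵥ (mulH (ι := ι) h *ᵥ Φ)))
      ≤ (2 * ((d : ℝ) + 1) * δ₁ * c' + (δ₂ + a * δ₃) * c) * ν Φ := by
  have hK := supN_kOpR_le F e a m2 Ωc Ac hn ha hh (G *ᵥ (mulH (ι := ι) h *ᵥ Φ))
  have h0 : supN (G *ᵥ (mulH (ι := ι) h *ᵥ Φ)) ≤ c * ν Φ :=
    (hG _).trans (mul_le_mul_of_nonneg_left hν hc)
  have h1 : ∀ μ : Fin (d + 1), supN (covDeriv n (fineDom n Ωc) (fieldLink F (e / n) (acBond Ωc Ac)) μ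
      *ᵥ (G *ᵥ (mulH (ι := ι) h *ᵥ Φ))) ≤ c' * ν Φ := fun μ =>
    (hD μ _).trans (mul_le_mul_of_nonneg_left hν hc')
  have hsum : ∑ μ : Fin (d + 1), supN (covDeriv n (fineDom n Ωc) (fieldLink F (e / n) (acBond Ωc Ac)) μ
      *ᵥ (G *ᵥ (mulH (ι := ι) h *ᵥ Φ))) ≤ ((d : ℝ) + 1) * (c' * ν Φ) := by
    refine (sum_le_sum fun μ _ => h1 μ).trans ?_
    rw [sum_const, card_univ, Fintype.card_fin, nsmul_eq_mul, Nat.cast_add, Nat.cast_one]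
  have hδ₁ : 0 ≤ δ₁ * 2 := by linarith [hh.nonneg₁]
  have hδ₂₃ : 0 ≤ δ₂ + a * δ₃ := add_nonneg hh.nonneg₂ (mul_nonneg ha hh.nonneg₃)
  calc _ ≤ _ := hK
    _ ≤ δ₁ * (2 * (((d : ℝ) + 1) * (c' * ν Φ))) + (δ₂ + a * δ₃) * (c * ν Φ) :=
        add_le_add (by rw [← mul_assoc, ← mul_assoc]; exact mul_le_mul_of_nonneg_left hsum hδ₁)
          (mul_le_mul_of_nonneg_left h0 hδ₂₃)
    _ = (2 * ((d : ℝ) + 1) * δ₁ * c' + (δ₂ + a * δ₃) * c) * ν Φ := by ring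

end Reduction

/-! ## §4. LEMMA 2.1 (2.15) ⇒ THE `‖·‖_{2,2}` FACTOR OF (2.21) AT THE BOUNDARY CUBES -/

section L2

variable {X : Type*} [Fintype X]

omit [DecidableEq ι] in
/-- `‖Φ‖₂ = √⟨Φ,Φ⟩`: the mixed norm at `p = 2` is the Euclidean norm. [folklore] -/
private theorem lpM_two_eq_sqrt (Φ : X × ι → ℝ) : lpM 2 Φ = Real.sqrt (Φ ⬝ᵥ Φ) := by
  rw [lpM, lpS, Real.sqrt_eq_rpow, dotProduct_eq_sum_fld]
  have h2 : (2 : ℝ)⁻¹ = 1 / 2 := by norm_num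
  rw [h2]
  congr 1
  refine sum_congr rfl fun x _ => ?_
  rw [abs_of_nonneg (siteNorm_nonneg _), siteNorm,
    show ((2 : ℝ)) = ((2 : ℕ) : ℝ) by norm_num, Real.rpow_natCast, Real.sq_sqrt (dotProduct_self_nonneg' _)]

omit [DecidableEq ι] in
/-- from a squared bound `γ‖Ψ‖₂² ≤ ‖Φ‖₂²` (`γ > 0`) to `‖Ψ‖₂ ≤ γ^{−1/2}‖Φ‖₂`. [folklore] -/
private theorem lpM_two_le_of_sq {Y : Type*} [Fintype Y] {γ : ℝ} (hγ : 0 < γ) {Ψ : Y × ι → ℝ} {Φ : X × ι → ℝ}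
    (h : γ * (Ψ ⬝ᵥ Ψ) ≤ Φ ⬝ᵥ Φ) : lpM 2 Ψ ≤ (Real.sqrt γ)⁻¹ * lpM 2 Φ := by
  rw [lpM_two_eq_sqrt, lpM_two_eq_sqrt]
  have hs : 0 < Real.sqrt γ := Real.sqrt_pos.2 hγ
  rw [le_inv_mul_iff₀ hs, ← Real.sqrt_mul hγ.le]
  exact Real.sqrt_le_sqrt h

variable (F : OrthFlow ι) {ℓ : ℝ} (hℓ : 0 ≤ ℓ)
  (hLip : ∀ t (v : ι → ℝ), ((F.U t - 1) *ᵥ v) ⬝ᵥ ((F.U t - 1) *ᵥ v) ≤ (ℓ * t) ^ 2 * (v ⬝ᵥ v))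
  {e : ℝ} (he : 0 < e) {n : ℕ} (hn : 1 ≤ n) {a : ℝ} (ha : 0 < a) {m2 : ℝ} (hm : 0 ≤ m2)
  (Ωc : Finset (Fin (d + 1) → ℤ)) {Ac : (Fin (d + 1) → ℤ) → Fin (d + 1) → ℝ} {c β : ℝ} (hc : 0 ≤ c)
  (h17 : ∀ x ∈ fineDom n Ωc, ∀ μ ν : Fin (d + 1), |Ac (x + e1 μ) ν - Ac x ν| ≤ c * e ^ (β - 1) / n)
  (hsmall : ℓ ^ 2 * ((d + 1) * c * e ^ β) ^ 2 * (d + 1) * (1 + a * (d + 1)) ≤ min 2 a / 4)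

include hℓ hLip he ha hm hc h17 hsmall

/-- **(2.15) IN THE MIXED `ℓ²` NORM**: `‖G_k(□,A)f‖₂ ≤ γ⁻¹‖f‖₂` and `‖D^η_{A,μ}G_k(□,A)f‖₂ ≤ γ^{−1/2}‖f‖₂`,
`γ = min(2,a)/4 + m²`, from `B4Lemma21Region.green_sq_le_region`/`deriv_green_sq_le_region`.
[cite: Balaban1983RegularityDecay, Lemma 2.1 (2.15) p. 577; proof p. 580] -/
theorem lemma21_lpM_two (f : ↥(fineDom n Ωc) × ι → ℝ) :
    lpM 2 ((regionOp F e hn a m2 Ωc Ac)⁻¹ *ᵥ f) ≤ (min 2 a / 4 + m2)⁻¹ * lpM 2 f ∧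
    ∀ μ : Fin (d + 1), lpM 2 (regionDeriv F e n Ωc Ac μ *ᵥ ((regionOp F e hn a m2 Ωc Ac)⁻¹ *ᵥ f))
      ≤ (Real.sqrt (min 2 a / 4 + m2))⁻¹ * lpM 2 f := by
  have hγ : 0 < min 2 a / 4 + m2 := add_pos_of_pos_of_nonneg (div_pos (lt_min two_pos ha) four_pos) hm
  refine ⟨?_, fun μ => lpM_two_le_of_sq hγ (deriv_green_sq_le_region F hℓ hLip he hn ha hm Ωc hc h17 hsmall μ f)⟩
  have h := green_sq_le_region F hℓ hLip he hn ha hm Ωc hc h17 hsmall f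
  have h' : (min 2 a / 4 + m2) ^ 2 * (((regionOp F e hn a m2 Ωc Ac)⁻¹ *ᵥ f) ⬝ᵥ ((regionOp F e hn a m2 Ωc Ac)⁻¹ *ᵥ f))
      ≤ f ⬝ᵥ f := h
  have h2 := lpM_two_le_of_sq (pow_pos hγ 2) h'
  rwa [Real.sqrt_sq hγ.le] at h2

/-- **THE `‖·‖_{2,2}` FACTOR OF (2.21) AT A BOUNDARY CUBE FROM LEMMA 2.1**: on an ARBITRARY finite union `□` of unit
blocks («not necessarily cubes or parallelepipeds»), for an ARBITRARY vector field `A` regular in the printed sense (1.7)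
(`|A_ν(x + e_μ) − A_ν(x)| ≤ ce^{β−1}/n` on `□`) and «e ≤ e₀» (`ℓ²((d+1)ce^β)²(d+1)(1 + a(d+1)) ≤ min(2,a)/4`), `a > 0`,
`m² ≥ 0`, Lipschitz orthogonal flow: for every `h` of sizes `(δ₁, δ₂, δ₃)` on `□` and every `Φ`,
`‖K_hG_k(□,A)(hΦ)‖₂ ≤ (2(d+1)δ₁γ^{−1/2} + (δ₂ + aδ₃)γ⁻¹)·‖Φ‖₂`, `γ = min(2,a)/4 + m²` — NO decomposition `A = A₀ + A′`
and no smallness of `A′` («if □_j intersects the boundary of Ω, then Ã_j = A»).  `eq221_region_reduction_lp` at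
`q = 2` fed with `lemma21_lpM_two`.
[cite: Balaban1983RegularityDecay, (2.21) p. 578 «‖K_{ω_i}G_k(□_{ω_i},Ã_{ω_i})h_{ω_i}‖_{2,2}» with Lemma 2.1 (2.15) p. 577 and (2.10) p. 576] -/
theorem eq221_l2_region {δ₁ δ₂ δ₃ : ℝ} {h : ↥(fineDom n Ωc) → ℝ} (hh : HSizeR n Ωc h δ₁ δ₂ δ₃)
    (Φ : ↥(fineDom n Ωc) × ι → ℝ) :
    lpM 2 (kOpR F e hn a m2 Ωc Ac h *ᵥ ((regionOp F e hn a m2 Ωc Ac)⁻¹ *ᵥ (mulH (ι := ι) h *ᵥ Φ)))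
      ≤ (2 * ((d : ℝ) + 1) * δ₁ * (Real.sqrt (min 2 a / 4 + m2))⁻¹ + (δ₂ + a * δ₃) * (min 2 a / 4 + m2)⁻¹)
        * lpM 2 Φ := by
  have hγ : 0 < min 2 a / 4 + m2 := add_pos_of_pos_of_nonneg (div_pos (lt_min two_pos ha) four_pos) hm
  have hL := lemma21_lpM_two F hℓ hLip he hn ha hm Ωc hc h17 hsmall
  exact eq221_region_reduction_lp (ν := lpM 2) F e a m2 Ωc Ac hn ha.le (by norm_num : (1 : ℝ) ≤ 2)
    (inv_nonneg.2 hγ.le) (inv_nonneg.2 (Real.sqrt_nonneg _)) ((regionOp F e hn a m2 Ωc Ac)⁻¹)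
    (fun Ψ => (hL Ψ).1) (fun μ Ψ => (hL Ψ).2 μ) hh Φ (lpM_mulH_le two_pos hh.abs_le Φ)

/-- **THE PRINTED SHAPE «‖K_jG_k(□_j,Ã_j)h_j‖_{2,2} ≤ c₂O(1)M⁻¹» AT A BOUNDARY CUBE**: for `h` with the printed sizes
`δ₁ = δ₃ = s/K`, `δ₂ = s/K²` (`K ≥ 1` the large-cube size, the print's `M`; `s ≥ 0`),
`‖K_hG_k(□,A)(hΦ)‖₂ ≤ (2(d+1)γ^{−1/2} + (1 + a)γ⁻¹)·s·K⁻¹·‖Φ‖₂`.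
[cite: Balaban1983RegularityDecay, (2.21) p. 578 «c₂O(1)M⁻¹» with p. 577 «|∂^ηh_j| ≤ O(M⁻¹), |Δ^ηh_j| ≤ O(M⁻²)» and Lemma 2.1 (2.15) p. 577] -/
theorem eq221_l2_region_Minv {s Kr : ℝ} (hK : 1 ≤ Kr) (hs : 0 ≤ s) {h : ↥(fineDom n Ωc) → ℝ}
    (hh : HSizeR n Ωc h (s / Kr) (s / Kr ^ 2) (s / Kr)) (Φ : ↥(fineDom n Ωc) × ι → ℝ) :
    lpM 2 (kOpR F e hn a m2 Ωc Ac h *ᵥ ((regionOp F e hn a m2 Ωc Ac)⁻¹ *ᵥ (mulH (ι := ι) h *ᵥ Φ)))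
      ≤ (2 * ((d : ℝ) + 1) * (Real.sqrt (min 2 a / 4 + m2))⁻¹ + (1 + a) * (min 2 a / 4 + m2)⁻¹) * s / Kr
        * lpM 2 Φ := by
  have hγ : 0 < min 2 a / 4 + m2 := add_pos_of_pos_of_nonneg (div_pos (lt_min two_pos ha) four_pos) hm
  refine (eq221_l2_region F hℓ hLip he hn ha hm Ωc hc h17 hsmall hh Φ).trans
    (mul_le_mul_of_nonneg_right ?_ (lpM_nonneg _ _))
  have hKpos : 0 < Kr := lt_of_lt_of_le one_pos hK
  have hg1 : 0 ≤ (min 2 a / 4 + m2)⁻¹ := inv_nonneg.2 hγ.le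
  have h1 : s / Kr ^ 2 ≤ s / Kr := div_le_div_of_nonneg_left hs hKpos (by nlinarith)
  have h2 : (2 * ((d : ℝ) + 1) * (Real.sqrt (min 2 a / 4 + m2))⁻¹ + (1 + a) * (min 2 a / 4 + m2)⁻¹) * s / Kr
      = 2 * ((d : ℝ) + 1) * (s / Kr) * (Real.sqrt (min 2 a / 4 + m2))⁻¹
        + (s / Kr + a * (s / Kr)) * (min 2 a / 4 + m2)⁻¹ := by ring
  rw [h2]
  have h3 := mul_le_mul_of_nonneg_right h1 hg1
  nlinarith

end L2

end

end Literature.MathematicalPhysics.QuantumFieldTheory.Balaban1983to89.B4Eq221L2FactorRegion
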